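import Summits.Langlands.Langlands.Theorems.PhantomRMYoshidaResiduallyYoshidaLiftingRealisedCocycleIdentity
import Summits.Langlands.Langlands.Theorems.PhantomRMYoshidaResiduallyYoshidaLiftingRealisedCocycleLocallyConstant
import Summits.Langlands.Langlands.Theorems.PhantomRMYoshidaResiduallyYoshidaLiftingRealisedCocycleUnramified
import Summits.Langlands.Langlands.Theorems.PhantomRMYoshidaResiduallyYoshidaLiftingRealisedCocycleGreenberg
import Summits.Langlands.Langlands.Theorems.PhantomRMYoshidaResiduallyYoshidaLiftingDefs
import HarnessLib

/-!
# Route `PhantomRMYoshida`, crux `ResiduallyYoshidaLifting` (stmt-Langlands-13639), line `sector-klingen-split`: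
# stub K3 `stub_realisedClassSelmer` — the realised class of an `Sh`-point is a Greenberg–Selmer cocycle

Stub-worker file of lead prover-line-stmt-Langlands-13639-c4-0 (skeleton rev 11, sub-goal K3 = census R1(b) COMPLETE).

**Theorem (`stub_realisedClassSelmer`, registered signature verbatim).**  Let the cocycle `B : Γ_ℚ → M₂(k)` be
REALISED by an `Sh`-point `ρ : Γ_ℚ → GL₄(ℚ̄_p)` through the integral frame `(P, rint)` (`rint = P⁻¹ ρ P`, a
homomorphism into `GL₄(ℤ̄_p)`) with reduction conjugator `h` (`red ∘ rint = h (σ̄, B; 0, σ̄') h⁻¹`), on a fibre with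
`det σ̄ = det σ̄' = ε̄⁻¹` (`DetC`), `p ≠ 2`.  Then `B` is a GREENBERG–SELMER cocycle for the ramification of `ρ`:
1. the 1-cocycle identity `B (g g') = σ̄ g · B g' + B g · σ̄' g'` (landed `Ribet.stub_realisedCocycleIdentity`);
2. `B` is locally constant on `Γ_ℚ` (Krull topology) (landed K1 `Fibre.stub_realisedCocycleLocallyConstant`);
3. `B` vanishes on the inertia groups above every place where `ρ` is unramified (landed
   `Ribet.stub_realisedCocycleUnramified`, third component);
4. the Greenberg condition at every `v ∣ p` (landed N1 `Fibre.stub_realisedCocycleGreenberg`, verbatim).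

**Proof.**  `refine ⟨_, _, _, _⟩` with the four landed theorems.  No new definitions, no named fact taken as a
hypothesis; Mathlib + the landed files above.
-/

noncomputable section

-- `Summit.Langlands.Langlands.…` (summit = sub-problem name, D-0017 layout) trips `dupNamespace` on every decl.
set_option linter.dupNamespace false
set_option autoImplicit false

open IsDedekindDomain Filter
open scoped Matrix
open Literature.NumberTheory.GaloisRepresentations Literature.NumberTheory.Automorphic
open Summit.Langlands.Langlands.Cruxes.ResiduallyYoshidaLifting.YoshidaDivisorSelmerCount

namespace Summit.Langlands.Langlands.Cruxes.ResiduallyYoshidaLifting.SectorKlingenSplit.Fibre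

/-- **Registered sub-goal K3 `stub_realisedClassSelmer`** (crux stmt-Langlands-13639, line `sector-klingen-split`,
skeleton rev 11; census R1(b) COMPLETE): the cocycle `B` realised by an `Sh`-point `ρ` on a `DetC` fibre (`p ≠ 2`) is a
GREENBERG–SELMER cocycle for the ramification of `ρ`: (i) the 1-cocycle identity, (ii) locally constant, (iii) vanishing
on the inertia groups above every place where `ρ` is unramified, (iv) the Greenberg condition at every `v ∣ p` (after a
coboundary change it kills the inertia-invariant line of `σ̄'` on inertia).  Bundles `Ribet.stub_realisedCocycleIdentity`,
`Fibre.stub_realisedCocycleLocallyConstant`, `Ribet.stub_realisedCocycleUnramified` (third component) and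
`Fibre.stub_realisedCocycleGreenberg`. [folklore] -/
theorem stub_realisedClassSelmer :
    ∀ (p : ℕ) [Fact p.Prime], p ≠ 2 → ∀ (k : Type) [Field k] [CharP k p] [IsAlgClosed k]
      [TopologicalSpace k] [DiscreteTopology k] (red : Valued.integer (PadicAlgCl p) →+* k)
      (σ σ' : FramedGaloisRep ℚ k 2) (ρ : FramedGaloisRep ℚ (PadicAlgCl p) 4)
      (P : GL (Fin 4) (PadicAlgCl p)) (rint : Field.absoluteGaloisGroup ℚ →* GL (Fin 4) (Valued.integer (PadicAlgCl p)))
      (h : GL (Fin 4) k) (B : Field.absoluteGaloisGroup ℚ → Matrix (Fin 2) (Fin 2) k),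
      DetC p k σ σ' → Sh p k red σ σ' ρ →
      (∀ g, Matrix.GeneralLinearGroup.map (Valued.integer (PadicAlgCl p)).subtype (rint g) = P⁻¹ * ρ g * P) →
      (∀ g, (Matrix.GeneralLinearGroup.map red (rint g)).val =
        h.val * Matrix.reindex finSumFinEquiv finSumFinEquiv (Matrix.fromBlocks (σ g).val (B g) 0 (σ' g).val) * (h⁻¹).val) →
      (∀ g g', B (g * g') = (σ g).val * B g' + B g * (σ' g').val) ∧ IsLocallyConstant B ∧
      (∀ v : HeightOneSpectrum (NumberField.RingOfIntegers ℚ), ρ.IsUnramifiedAt v →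
        ∀ 𝔓 ∈ v.primesAbove, ∀ i ∈ 𝔓.inertia (Field.absoluteGaloisGroup ℚ), B i = 0) ∧
      (∀ v : HeightOneSpectrum (NumberField.RingOfIntegers ℚ), ((p : ℕ) : NumberField.RingOfIntegers ℚ) ∈ v.asIdeal →
        ∃ (X₀ : Matrix (Fin 2) (Fin 2) k) (x₁ y₁ : Fin 2 → k), x₁ ≠ 0 ∧ y₁ ≠ 0 ∧
          (∀ τ ∈ absInertia (v.adicCompletion ℚ),
            (σ (absGaloisRestrict ℚ (v.adicCompletion ℚ) τ)).val *ᵥ x₁ = x₁) ∧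
          (∀ τ ∈ absInertia (v.adicCompletion ℚ),
            (σ' (absGaloisRestrict ℚ (v.adicCompletion ℚ) τ)).val *ᵥ y₁ = y₁) ∧
          ∀ τ ∈ absInertia (v.adicCompletion ℚ),
            (B (absGaloisRestrict ℚ (v.adicCompletion ℚ) τ) -
              ((σ (absGaloisRestrict ℚ (v.adicCompletion ℚ) τ)).val * X₀ -
                X₀ * (σ' (absGaloisRestrict ℚ (v.adicCompletion ℚ) τ)).val)) *ᵥ y₁ = 0) := by
  intro p _ hp k _ _ _ _ _ red σ σ' ρ P rint h B hDet hSh hP hred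
  exact ⟨Ribet.stub_realisedCocycleIdentity p k red σ σ' rint h B hred,
    stub_realisedCocycleLocallyConstant p k red σ σ' ρ P rint h B hP hred,
    fun v hv => (Ribet.stub_realisedCocycleUnramified p k red σ σ' ρ P rint h B hP hred v hv).2.2,
    fun v hv => stub_realisedCocycleGreenberg p hp k red σ σ' ρ P rint h B v hv hDet hSh hP hred⟩

end Summit.Langlands.Langlands.Cruxes.ResiduallyYoshidaLifting.SectorKlingenSplit.Fibre

end
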